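import Summits.QuantumFields.YangMills.Theorems.BalabanUVNodesN15CovariantLandauGradRowLeibniz
import HarnessLib

/-!
# Route «BalabanUVNodes», node N15 = NE2, road (c) — PROGRAMME (P-S), XXI: THE COVARIANT GRADIENT-DIFFERENCE ROW `D_TG′(T) − ∂G′(1)` — THE LAST DISPLAYED ONE-GRID ROW OF n15-c∕217∕223 —
# AS A THEOREM from the flat rows, the rows of `G′(T)` (228) and `∂G′(T)` (229) and the transporter letters: `D_TG′(T) − ∂G′(1) = (S₂ − ∂G′(1)) + K₂·∂G′(T) − B·G′(T)`, every word carrying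
# a letter (dag-n15-c g23, n15-c∕230; HOME HANDOFF «BRICK D», file D3)

Cell `pub-ymgap`, seat `pub-ymgap-dag-n15-c` (generation g23; R134 (a), s1; HUMAN RULING D-0062; chair R424 venue).  `bears_on: R4∕N15 · K3⁸ SpineGivenEndpointR13SepCoPHV
(stmt-QuantumFields-27366)`; filed `--supports stmt-QuantumFields-27366 --as helper` — COUNT-NEUTRAL.  One theorem; 0 `sorry`.  Imports BY NAME n15-c∕229 and through it 224–228, 215, 213, 205,
lit-balaban∕b11.  Nothing in the tree is modified.

WHY.  n15-c∕217 `hasMaj_landauCov_sub_of_flat` displays ONE covariant row, `hδD : D_TG′(T) − ∂G′(1) ≤ P₀·r·e^{−δd}` ([Balaban1985BackgroundPropagators] Thm 3.4 shape — the Schauder-type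
estimate).  With `D_T = ∂ − B`, `B = 𝔇_W S`: `D_TG′(T) − ∂G′(1) = (∂G′(T) − ∂G′(1)) − BG′(T)` and `∂G′(T) − ∂G′(1) = ∂G′(1)(Δ′(1) − Δ′(T))G′(T) = (S₂ − ∂G′(1)) + K₂·∂G′(T)` (229's expansion):
every word contains `B`, `Bᵀ`, `div_n W` or an averaging difference — so the row is LINEAR IN THE LETTERS (`nρ`, `n²λ`, `σ`), i.e. `O(r)` for the knit's transporters (n15-c∕218, 226).  THIS
FILE proves that row from the flat `∂G′(1)` (PROVED, n15-c∕220), the rows `X` of `G′(T)` and `Y` of `∂G′(T)` (n15-c∕228–229) and the letters.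
* ★★★ **`hasMaj_cgrad_cGreen_sub_of_flat'`**.

HONEST FRAMING ∕ LIMITS.  Bookkeeping in the sup-block-row calculus (no Hölder norms: the smoothness of the perturbation enters through the Lipschitz letter `λ`); the rows `C_D`, `X`, `Y` are
HYPOTHESES here (theorems by n15-c∕220, 228, 229); MODEL carriers; NOT [Balaban1985BackgroundPropagators] Thm 3.4 as printed; NE2⁺ NOT PRINTED; N15 of record untouched (DISCHARGED AS CONSUMED,
p687738); counts UNMOVED (typed 28∕28 · discharged 8∕27); one finite 𝕋⁴ at fixed ε per index — NOT infinite volume ∕ OS ∕ mass gap ∕ Clay.  Restate-immune (no Theses import).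
-/

noncomputable section

open scoped BigOperators Matrix
open Finset

namespace Summit.QuantumFields.YangMills.BalabanUVNodes.N15.CovLandau

open Literature.MathematicalPhysics.QuantumFieldTheory.Balaban1983to89
open Literature.MathematicalPhysics.QuantumFieldTheory.Balaban1983to89.B5Prop11Plancherel (Tor fine unitVec)
open Literature.MathematicalPhysics.QuantumFieldTheory.Balaban1983to89.B11SectG (BlockNorm HasMaj RowSum hasMaj_comp_exp)
open Literature.MathematicalPhysics.QuantumFieldTheory.Balaban1983to89.B6UnitTorusCarrier (unitTorusGeo rowSum_unitTorusGeo triangle254_unitTorusGeo unitTorusGeo_dist_nonneg)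
open Literature.MathematicalPhysics.QuantumFieldTheory.Balaban1983to89.T4EtaRateCoeffDefect (fibre mem_fibre)
open Literature.MathematicalPhysics.QuantumFieldTheory.King1986.Torus (blockOf tdistT tdistT_nonneg tdistT_symm tdistT_self)
open Summit.QuantumFields.YangMills.BalabanUVNodes.N15.MatrixSpecies (liftBlk)
open Summit.QuantumFields.YangMills.BalabanUVNodes.N15.CovAvg (cvaStair cvaStair_one)
open Summit.QuantumFields.YangMills.BalabanUVNodes.N15.BackgroundModel (kappa_ofBlocks)
open Summit.QuantumFields.YangMills.BalabanUVNodes.N15.TwoGrid (hasMaj_smul_ofBlocks)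
open Summit.QuantumFields.YangMills.BalabanUVNodes.N15.BlockRows (hasMaj_mulVecLin_of_sum_abs_le hasMaj_comp_localRight)

variable {d : ℕ}

section GradDiff

variable (M : Fin (d + 1) → ℕ) [∀ μ, NeZero (M μ)] (n : ℕ) [NeZero n] {ι : Type} [Fintype ι] [DecidableEq ι] (L k : ℕ)

set_option maxHeartbeats 1000000 in
/-- ★★★ **THE COVARIANT GRADIENT-DIFFERENCE ROW AS A THEOREM**: from `∂G′(1) ≤ C_De^{−δd}`, `G′(T) ≤ Xe^{−(δ−2s)d}`, `∂G′(T) ≤ Ye^{−(δ−3s)d}` and the letters `ρ, λ, σ, τ`: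
`D_TG′(T) − ∂G′(1) ≤ P·e^{−(δ−4s)d}` with
`P = [C_D(d+1)n(nλ) + C_D(n(d+1)ρe^{δ+s})(nρe^{δ+s})c + |a|C_Dn^{−(d+1)}(στ + σ)]·X·c + [C_D(n(d+1)ρe^{δ})c + C_D(d+1)(nρ)]·Y·c + (nρe^{δ+s})·X·c` — LINEAR in the letters.
[cite: Balaban1985BackgroundPropagators, Thm 3.4 p.400 (shape), Lemma 3.3 (3.55)–(3.62) p.402; Balaban1984PropagatorsII, (2.52)–(2.56) pp.232–233] -/
theorem hasMaj_cgrad_cGreen_sub_of_flat' {T : Fin (d + 1) → Tor (fine n M) → Matrix ι ι ℝ} (hT : ∀ ν x, IsUnit (T ν x)) {a : ℝ} (ha : 0 < a)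
    {δ s c CD X Y ρ lam σ τ : ℝ} (hs : 0 < s) (hsδ : 4 * s ≤ δ) (hrow : RowSum (unitTorusGeo L k M) s c) (hc : 0 ≤ c)
    (hCD : 0 ≤ CD) (hX : 0 ≤ X) (hY0 : 0 ≤ Y) (hρ0 : 0 ≤ ρ) (hlam0 : 0 ≤ lam) (hσ0 : 0 ≤ σ) (hτ0 : 0 ≤ τ)
    (hρr : ∀ ν x i, ∑ j, |(T ν x - (fun (_ : Fin (d + 1)) (_ : Tor (fine n M)) => (1 : Matrix ι ι ℝ)) ν x) i j| ≤ ρ)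
    (hρc : ∀ ν x j, ∑ i, |(T ν x - (fun (_ : Fin (d + 1)) (_ : Tor (fine n M)) => (1 : Matrix ι ι ℝ)) ν x) i j| ≤ ρ)
    (hlamr : ∀ μ (z : Tor (fine n M)) i, ∑ j, |(T μ z - T μ (z - unitVec (fine n M) μ)) i j| ≤ lam)
    (hσr : ∀ y a' i, ∑ j, |(cvaStair M n (fun μ b => T μ b.1) y a' 0 - cvaStair M n (fun μ b => (fun (_ : Fin (d + 1)) (_ : Tor (fine n M)) => (1 : Matrix ι ι ℝ)) μ b.1) y a' 0) i j| ≤ σ)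
    (hσc : ∀ y a' j, ∑ i, |(cvaStair M n (fun μ b => T μ b.1) y a' 0 - cvaStair M n (fun μ b => (fun (_ : Fin (d + 1)) (_ : Tor (fine n M)) => (1 : Matrix ι ι ℝ)) μ b.1) y a' 0) i j| ≤ σ)
    (hτr : ∀ y a' i, ∑ j, |cvaStair M n (fun μ b => T μ b.1) y a' 0 i j| ≤ τ)
    (hD1 : HasMaj (BlockNorm.ofBlocks (unitTorusGeo L k M) (liftBlk (blockOf n M) ι)) (BlockNorm.ofBlocks (unitTorusGeo L k M) (liftBlk (fun b : Tor (fine n M) × Fin (d + 1) => blockOf n M b.1) ι)) (Matrix.mulVecLin ((cgrad M n (fun (_ : Fin (d + 1)) (_ : Tor (fine n M)) => (1 : Matrix ι ι ℝ))) * (cGreen M n (fun (_ : Fin (d + 1)) (_ : Tor (fine n M)) => (1 : Matrix ι ι ℝ)) a))) (fun y y' => CD * Real.exp (-(δ * tdistT M y y'))))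
    (hGT : HasMaj (BlockNorm.ofBlocks (unitTorusGeo L k M) (liftBlk (blockOf n M) ι)) (BlockNorm.ofBlocks (unitTorusGeo L k M) (liftBlk (blockOf n M) ι)) (Matrix.mulVecLin (cGreen M n T a)) (fun y y' => X * Real.exp (-((δ - 2 * s) * tdistT M y y'))))
    (hY : HasMaj (BlockNorm.ofBlocks (unitTorusGeo L k M) (liftBlk (blockOf n M) ι)) (BlockNorm.ofBlocks (unitTorusGeo L k M) (liftBlk (fun b : Tor (fine n M) × Fin (d + 1) => blockOf n M b.1) ι)) (Matrix.mulVecLin ((cgrad M n (fun (_ : Fin (d + 1)) (_ : Tor (fine n M)) => (1 : Matrix ι ι ℝ))) * (cGreen M n T a))) (fun y y' => Y * Real.exp (-((δ - 3 * s) * tdistT M y y')))) :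
    HasMaj (BlockNorm.ofBlocks (unitTorusGeo L k M) (liftBlk (blockOf n M) ι)) (BlockNorm.ofBlocks (unitTorusGeo L k M) (liftBlk (fun b : Tor (fine n M) × Fin (d + 1) => blockOf n M b.1) ι)) (Matrix.mulVecLin (cgrad M n T * (cGreen M n T a) - (cgrad M n (fun (_ : Fin (d + 1)) (_ : Tor (fine n M)) => (1 : Matrix ι ι ℝ))) * (cGreen M n (fun (_ : Fin (d + 1)) (_ : Tor (fine n M)) => (1 : Matrix ι ι ℝ)) a)))
      (fun y y' => ((CD * (((d : ℝ) + 1) * (n : ℝ) * ((n : ℝ) * lam)) * X * c + CD * (((n : ℝ) * ((d + 1 : ℕ) * ρ) * Real.exp (δ + s)) * ((n : ℝ) * ρ * Real.exp (δ + s)) * c) * c * X * c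
          + |a| * (CD * (((n : ℝ) ^ (d + 1))⁻¹ * σ * τ)) * X * c + |a| * (CD * (((n : ℝ) ^ (d + 1))⁻¹ * 1 * σ)) * X * c)
          + (CD * ((n : ℝ) * ((d + 1 : ℕ) * ρ) * Real.exp δ) * c + CD * (((d : ℝ) + 1) * ((n : ℝ) * ρ))) * Y * c
          + ((n : ℝ) * ρ * Real.exp (δ + s)) * X * c) * Real.exp (-((δ - 4 * s) * tdistT M y y'))) := by
  have hn : (0 : ℝ) < (n : ℝ) ^ (d + 1) := pow_pos (Nat.cast_pos.mpr (Nat.pos_of_ne_zero (NeZero.ne n))) _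
  have hn1 : (0 : ℝ) ≤ (n : ℝ) := Nat.cast_nonneg n
  have hδ : 0 ≤ δ := by linarith
  have htri := triangle254_unitTorusGeo L k M
  have hd := unitTorusGeo_dist_nonneg L k M
  have h1unit : ∀ (ν : Fin (d + 1)) (x : Tor (fine n M)), IsUnit ((fun (_ : Fin (d + 1)) (_ : Tor (fine n M)) => (1 : Matrix ι ι ℝ)) ν x) := fun _ _ => isUnit_one
  have hκS : (BlockNorm.ofBlocks (unitTorusGeo L k M) (liftBlk (blockOf n M) ι)).κ = 1 := kappa_ofBlocks _
  have hκV : (BlockNorm.ofBlocks (unitTorusGeo L k M) (liftBlk (fun b : Tor (fine n M) × Fin (d + 1) => blockOf n M b.1) ι)).κ = 1 := kappa_ofBlocks _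
  have hκC : (BlockNorm.ofBlocks (unitTorusGeo L k M) (liftBlk (fun y : Tor M => y) ι)).κ = 1 := kappa_ofBlocks _
  -- local rows
  have hDDs := hasMaj_cgrad_sub M n L k T hρ0 (by linarith : 0 ≤ δ + s) hρr
  have hDDt := hasMaj_cgrad_sub_transpose M n L k T hρ0 hδ hρc
  have hDDts := hasMaj_cgrad_sub_transpose M n L k T hρ0 (by linarith : 0 ≤ δ + s) hρc
  have hQQ := hasMaj_csavg_sub M n L k T hσ0 hσr
  have hQQt := hasMaj_csavg_sub_transpose M n L k T hσ0 hσc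
  have hQ := hasMaj_csavg M n L k T hτ0 hτr
  have hQ1t := hasMaj_csavg_transpose M n L k (fun (_ : Fin (d + 1)) (_ : Tor (fine n M)) => (1 : Matrix ι ι ℝ)) zero_le_one (stair_one_cols M n)
  have hWr : ∀ μ x i, ∑ j, |(fun ν x => (n : ℝ) • ((1 : Matrix ι ι ℝ) - T ν x)) μ x i j| ≤ (n : ℝ) * ρ := by
    intro μ x i
    have h := hρr μ x i
    calc ∑ j, |(fun ν x => (n : ℝ) • ((1 : Matrix ι ι ℝ) - T ν x)) μ x i j| = (n : ℝ) * ∑ j, |(T μ x - (fun (_ : Fin (d + 1)) (_ : Tor (fine n M)) => (1 : Matrix ι ι ℝ)) μ x) i j| := by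
          rw [Finset.mul_sum]; refine Finset.sum_congr rfl fun j _ => ?_
          simp only [Matrix.smul_apply, smul_eq_mul, abs_mul, abs_of_nonneg hn1, Matrix.sub_apply, Matrix.one_apply]
          rw [abs_sub_comm]
      _ ≤ (n : ℝ) * ρ := mul_le_mul_of_nonneg_left h hn1
  have hWlam : ∀ μ (z : Tor (fine n M)) i, ∑ j, |((fun ν x => (n : ℝ) • ((1 : Matrix ι ι ℝ) - T ν x)) μ (z - unitVec (fine n M) μ) - (fun ν x => (n : ℝ) • ((1 : Matrix ι ι ℝ) - T ν x)) μ z) i j| ≤ (n : ℝ) * lam := by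
    intro μ z i
    have h := hlamr μ z i
    calc ∑ j, |((fun ν x => (n : ℝ) • ((1 : Matrix ι ι ℝ) - T ν x)) μ (z - unitVec (fine n M) μ) - (fun ν x => (n : ℝ) • ((1 : Matrix ι ι ℝ) - T ν x)) μ z) i j| = (n : ℝ) * ∑ j, |(T μ z - T μ (z - unitVec (fine n M) μ)) i j| := by
          rw [Finset.mul_sum]; refine Finset.sum_congr rfl fun j _ => ?_
          simp only [Matrix.smul_apply, smul_eq_mul, Matrix.sub_apply]
          rw [← mul_sub, abs_mul, abs_of_nonneg hn1, sub_sub_sub_cancel_left]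
      _ ≤ (n : ℝ) * lam := mul_le_mul_of_nonneg_left h hn1
  have hV : ∀ z i, ∑ j, |bDiv M n (fun ν x => (n : ℝ) • ((1 : Matrix ι ι ℝ) - T ν x)) z i j| ≤ ((d : ℝ) + 1) * (n : ℝ) * ((n : ℝ) * lam) := fun z i => rows_bDiv_le M n (fun ν x => (n : ℝ) • ((1 : Matrix ι ι ℝ) - T ν x)) hWlam z i
  have hSD := hasMaj_sDiag_if M n L k (bDiv M n (fun ν x => (n : ℝ) • ((1 : Matrix ι ι ℝ) - T ν x))) (by positivity) hV
  have hCn := hasMaj_bContr_if M n L k (fun ν x => (n : ℝ) • ((1 : Matrix ι ι ℝ) - T ν x)) (by positivity) hWr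
  -- signed versions of `B`, `Bᵀ`
  have hBs : HasMaj (BlockNorm.ofBlocks (unitTorusGeo L k M) (liftBlk (blockOf n M) ι)) (BlockNorm.ofBlocks (unitTorusGeo L k M) (liftBlk (fun b : Tor (fine n M) × Fin (d + 1) => blockOf n M b.1) ι)) (Matrix.mulVecLin ((cgrad M n (fun (_ : Fin (d + 1)) (_ : Tor (fine n M)) => (1 : Matrix ι ι ℝ))) - cgrad M n T)) (fun y y' => (n : ℝ) * ρ * Real.exp (δ + s) * Real.exp (-((δ + s) * tdistT M y y'))) := by
    rw [show ((cgrad M n (fun (_ : Fin (d + 1)) (_ : Tor (fine n M)) => (1 : Matrix ι ι ℝ))) - cgrad M n T) = -(cgrad M n T - (cgrad M n (fun (_ : Fin (d + 1)) (_ : Tor (fine n M)) => (1 : Matrix ι ι ℝ)))) from (neg_sub _ _).symm, mulVecLin_neg']; exact hDDs.neg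
  have hBt : HasMaj (BlockNorm.ofBlocks (unitTorusGeo L k M) (liftBlk (fun b : Tor (fine n M) × Fin (d + 1) => blockOf n M b.1) ι)) (BlockNorm.ofBlocks (unitTorusGeo L k M) (liftBlk (blockOf n M) ι)) (Matrix.mulVecLin ((cgrad M n (fun (_ : Fin (d + 1)) (_ : Tor (fine n M)) => (1 : Matrix ι ι ℝ))) - cgrad M n T)ᵀ) (fun y y' => (n : ℝ) * ((d + 1 : ℕ) * ρ) * Real.exp δ * Real.exp (-(δ * tdistT M y y'))) := by
    rw [show ((cgrad M n (fun (_ : Fin (d + 1)) (_ : Tor (fine n M)) => (1 : Matrix ι ι ℝ))) - cgrad M n T) = -(cgrad M n T - (cgrad M n (fun (_ : Fin (d + 1)) (_ : Tor (fine n M)) => (1 : Matrix ι ι ℝ)))) from (neg_sub _ _).symm, Matrix.transpose_neg, mulVecLin_neg']; exact hDDt.neg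
  have hBts : HasMaj (BlockNorm.ofBlocks (unitTorusGeo L k M) (liftBlk (fun b : Tor (fine n M) × Fin (d + 1) => blockOf n M b.1) ι)) (BlockNorm.ofBlocks (unitTorusGeo L k M) (liftBlk (blockOf n M) ι)) (Matrix.mulVecLin ((cgrad M n (fun (_ : Fin (d + 1)) (_ : Tor (fine n M)) => (1 : Matrix ι ι ℝ))) - cgrad M n T)ᵀ) (fun y y' => (n : ℝ) * ((d + 1 : ℕ) * ρ) * Real.exp (δ + s) * Real.exp (-((δ + s) * tdistT M y y'))) := by
    rw [show ((cgrad M n (fun (_ : Fin (d + 1)) (_ : Tor (fine n M)) => (1 : Matrix ι ι ℝ))) - cgrad M n T) = -(cgrad M n T - (cgrad M n (fun (_ : Fin (d + 1)) (_ : Tor (fine n M)) => (1 : Matrix ι ι ℝ)))) from (neg_sub _ _).symm, Matrix.transpose_neg, mulVecLin_neg']; exact hDDts.neg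
  have hBB : HasMaj (BlockNorm.ofBlocks (unitTorusGeo L k M) (liftBlk (blockOf n M) ι)) (BlockNorm.ofBlocks (unitTorusGeo L k M) (liftBlk (blockOf n M) ι)) (Matrix.mulVecLin ((cgrad M n (fun (_ : Fin (d + 1)) (_ : Tor (fine n M)) => (1 : Matrix ι ι ℝ))) - cgrad M n T)ᵀ ∘ₗ Matrix.mulVecLin ((cgrad M n (fun (_ : Fin (d + 1)) (_ : Tor (fine n M)) => (1 : Matrix ι ι ℝ))) - cgrad M n T))
      (fun y y' => (BlockNorm.ofBlocks (unitTorusGeo L k M) (liftBlk (fun b : Tor (fine n M) × Fin (d + 1) => blockOf n M b.1) ι)).κ * ((n : ℝ) * ((d + 1 : ℕ) * ρ) * Real.exp (δ + s)) * ((n : ℝ) * ρ * Real.exp (δ + s)) * c * Real.exp (-(δ * tdistT M y y'))) :=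
    hasMaj_comp_exp (ρ := δ) htri hd hrow (by positivity) (by positivity) hδ (by linarith) (by linarith) hBts hBs
  -- `K₂ = ∂G′(1)·(Bᵀ − ℭ_W)`
  set θ₂ : ℝ := CD * ((n : ℝ) * ((d + 1 : ℕ) * ρ) * Real.exp δ) * c + CD * (((d : ℝ) + 1) * ((n : ℝ) * ρ)) with hθ₂
  have hθ₂0 : 0 ≤ θ₂ := by positivity
  have hK2 : HasMaj (BlockNorm.ofBlocks (unitTorusGeo L k M) (liftBlk (fun b : Tor (fine n M) × Fin (d + 1) => blockOf n M b.1) ι)) (BlockNorm.ofBlocks (unitTorusGeo L k M) (liftBlk (fun b : Tor (fine n M) × Fin (d + 1) => blockOf n M b.1) ι)) (Matrix.mulVecLin ((cgrad M n (fun (_ : Fin (d + 1)) (_ : Tor (fine n M)) => (1 : Matrix ι ι ℝ))) * (cGreen M n (fun (_ : Fin (d + 1)) (_ : Tor (fine n M)) => (1 : Matrix ι ι ℝ)) a)) ∘ₗ (Matrix.mulVecLin ((cgrad M n (fun (_ : Fin (d + 1)) (_ : Tor (fine n M)) => (1 : Matrix ι ι ℝ))) - cgrad M n T)ᵀ - Matrix.mulVecLin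 (bContr M n (fun ν x => (n : ℝ) • ((1 : Matrix ι ι ℝ) - T ν x))))) (fun y y' => θ₂ * Real.exp (-((δ - s) * tdistT M y y'))) := by
    rw [LinearMap.comp_sub]
    have e1 := hasMaj_comp_exp (ρ := δ - s) htri hd hrow hCD (by positivity) (by linarith) (by linarith) (by linarith) hD1 hBt
    have e2' : HasMaj (BlockNorm.ofBlocks (unitTorusGeo L k M) (liftBlk (fun b : Tor (fine n M) × Fin (d + 1) => blockOf n M b.1) ι)) (BlockNorm.ofBlocks (unitTorusGeo L k M) (liftBlk (fun b : Tor (fine n M) × Fin (d + 1) => blockOf n M b.1) ι)) (Matrix.mulVecLin ((cgrad M n (fun (_ : Fin (d + 1)) (_ : Tor (fine n M)) => (1 : Matrix ι ι ℝ))) * (cGreen M n (fun (_ : Fin (d + 1)) (_ : Tor (fine n M)) => (1 : Matrix ι ι ℝ)) a)) ∘ₗ Matrix.mulVecLin (bContr M n (fun ν x => (n : ℝ) • ((1 : Matrix ι ι ℝ) - T ν x))))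
        (fun y y' => CD * (((d : ℝ) + 1) * ((n : ℝ) * ρ)) * Real.exp (-((δ - s) * tdistT M y y'))) :=
      ((hasMaj_comp_localRight hD1 hCn fun y y' => by positivity).mono fun y y' => le_of_eq (by rw [hκS]; ring)).of_rate_le hd (by positivity) (by linarith : δ - s ≤ δ)
    refine (e1.sub e2').mono fun y y' => le_of_eq ?_
    rw [hθ₂, hκS]; ring
  -- the source `S₂`
  have hs1 : HasMaj (BlockNorm.ofBlocks (unitTorusGeo L k M) (liftBlk (blockOf n M) ι)) (BlockNorm.ofBlocks (unitTorusGeo L k M) (liftBlk (fun b : Tor (fine n M) × Fin (d + 1) => blockOf n M b.1) ι)) ((Matrix.mulVecLin ((cgrad M n (fun (_ : Fin (d + 1)) (_ : Tor (fine n M)) => (1 : Matrix ι ι ℝ))) * (cGreen M n (fun (_ : Fin (d + 1)) (_ : Tor (fine n M)) => (1 : Matrix ι ι ℝ)) a)) ∘ₗ Matrix.mulVecLin (sDiag M n (bDiv M n (fun ν x => (n : ℝ) • ((1 : Matrix ι ι ℝ) - T ν x))))) ∘ₗ Matrix.mulVecLin (cGreen M n T a))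
      (fun y y' => (BlockNorm.ofBlocks (unitTorusGeo L k M) (liftBlk (blockOf n M) ι)).κ * (CD * (((d : ℝ) + 1) * (n : ℝ) * ((n : ℝ) * lam))) * X * c * Real.exp (-((δ - 3 * s) * tdistT M y y'))) := by
    have h1 : HasMaj (BlockNorm.ofBlocks (unitTorusGeo L k M) (liftBlk (blockOf n M) ι)) (BlockNorm.ofBlocks (unitTorusGeo L k M) (liftBlk (fun b : Tor (fine n M) × Fin (d + 1) => blockOf n M b.1) ι)) (Matrix.mulVecLin ((cgrad M n (fun (_ : Fin (d + 1)) (_ : Tor (fine n M)) => (1 : Matrix ι ι ℝ))) * (cGreen M n (fun (_ : Fin (d + 1)) (_ : Tor (fine n M)) => (1 : Matrix ι ι ℝ)) a)) ∘ₗ Matrix.mulVecLin (sDiag M n (bDiv M n (fun ν x => (n : ℝ) • ((1 : Matrix ι ι ℝ) - T ν x))))) (fun y y' => CD * (((d : ℝ) + 1) * (n : ℝ) * ((n : ℝ) * lam)) * Real.exp (-(δ * tdistT M y y'))) :=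
      (hasMaj_comp_localRight hD1 hSD fun y y' => by positivity).mono fun y y' => le_of_eq (by rw [hκS]; ring)
    exact hasMaj_comp_exp (ρ := δ - 3 * s) htri hd hrow (by positivity) hX (by linarith) (by linarith) (by linarith) h1 hGT
  have hs2 : HasMaj (BlockNorm.ofBlocks (unitTorusGeo L k M) (liftBlk (blockOf n M) ι)) (BlockNorm.ofBlocks (unitTorusGeo L k M) (liftBlk (fun b : Tor (fine n M) × Fin (d + 1) => blockOf n M b.1) ι)) ((Matrix.mulVecLin ((cgrad M n (fun (_ : Fin (d + 1)) (_ : Tor (fine n M)) => (1 : Matrix ι ι ℝ))) * (cGreen M n (fun (_ : Fin (d + 1)) (_ : Tor (fine n M)) => (1 : Matrix ι ι ℝ)) a)) ∘ₗ (Matrix.mulVecLin ((cgrad M n (fun (_ : Fin (d + 1)) (_ : Tor (fine n M)) => (1 : Matrix ι ι ℝ))) - cgrad M n T)ᵀ ∘ₗ Matrix.mulVecLin ((cgrad M n (fun (_ : Fin (d + 1)) (_ : Tor (fine n M)) => (1 : Matrix ι ι ℝ))) - cgrad M n T))) ∘ₗ Matrix.mulVecLin (cGreen M n T a))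
      (fun y y' => (BlockNorm.ofBlocks (unitTorusGeo L k M) (liftBlk (blockOf n M) ι)).κ * ((BlockNorm.ofBlocks (unitTorusGeo L k M) (liftBlk (blockOf n M) ι)).κ * CD * ((BlockNorm.ofBlocks (unitTorusGeo L k M) (liftBlk (fun b : Tor (fine n M) × Fin (d + 1) => blockOf n M b.1) ι)).κ * ((n : ℝ) * ((d + 1 : ℕ) * ρ) * Real.exp (δ + s)) * ((n : ℝ) * ρ * Real.exp (δ + s)) * c) * c) * X * c * Real.exp (-((δ - 3 * s) * tdistT M y y'))) := by
    have h1 := hasMaj_comp_exp (ρ := δ - s) htri hd hrow hCD (by rw [hκV]; positivity) (by linarith) (by linarith) (by linarith) hD1 hBB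
    exact hasMaj_comp_exp (ρ := δ - 3 * s) htri hd hrow (by rw [hκS, hκV]; positivity) hX (by linarith) (by linarith) (by linarith) h1 hGT
  have hs3 : HasMaj (BlockNorm.ofBlocks (unitTorusGeo L k M) (liftBlk (blockOf n M) ι)) (BlockNorm.ofBlocks (unitTorusGeo L k M) (liftBlk (fun b : Tor (fine n M) × Fin (d + 1) => blockOf n M b.1) ι)) ((Matrix.mulVecLin ((cgrad M n (fun (_ : Fin (d + 1)) (_ : Tor (fine n M)) => (1 : Matrix ι ι ℝ))) * (cGreen M n (fun (_ : Fin (d + 1)) (_ : Tor (fine n M)) => (1 : Matrix ι ι ℝ)) a)) ∘ₗ Matrix.mulVecLin ((csavg M n T - csavg M n (fun (_ : Fin (d + 1)) (_ : Tor (fine n M)) => (1 : Matrix ι ι ℝ)))ᵀ * csavg M n T)) ∘ₗ Matrix.mulVecLin (cGreen M n T a))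
      (fun y y' => (BlockNorm.ofBlocks (unitTorusGeo L k M) (liftBlk (blockOf n M) ι)).κ * (CD * (((n : ℝ) ^ (d + 1))⁻¹ * σ * τ)) * X * c * Real.exp (-((δ - 3 * s) * tdistT M y y'))) := by
    have hinner := hasMaj_comp_localRight hQQt hQ fun y y' => by positivity
    have hinner' : HasMaj (BlockNorm.ofBlocks (unitTorusGeo L k M) (liftBlk (blockOf n M) ι)) (BlockNorm.ofBlocks (unitTorusGeo L k M) (liftBlk (blockOf n M) ι)) (Matrix.mulVecLin ((csavg M n T - csavg M n (fun (_ : Fin (d + 1)) (_ : Tor (fine n M)) => (1 : Matrix ι ι ℝ)))ᵀ * csavg M n T)) (fun y y' => if y = y' then ((n : ℝ) ^ (d + 1))⁻¹ * σ * ((BlockNorm.ofBlocks (unitTorusGeo L k M) (liftBlk (fun y : Tor M => y) ι)).κ * τ) else 0) := by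
      rw [Matrix.mulVecLin_mul]; exact hinner.mono fun y y' => by split_ifs <;> simp
    have h1 : HasMaj (BlockNorm.ofBlocks (unitTorusGeo L k M) (liftBlk (blockOf n M) ι)) (BlockNorm.ofBlocks (unitTorusGeo L k M) (liftBlk (fun b : Tor (fine n M) × Fin (d + 1) => blockOf n M b.1) ι)) (Matrix.mulVecLin ((cgrad M n (fun (_ : Fin (d + 1)) (_ : Tor (fine n M)) => (1 : Matrix ι ι ℝ))) * (cGreen M n (fun (_ : Fin (d + 1)) (_ : Tor (fine n M)) => (1 : Matrix ι ι ℝ)) a)) ∘ₗ Matrix.mulVecLin ((csavg M n T - csavg M n (fun (_ : Fin (d + 1)) (_ : Tor (fine n M)) => (1 : Matrix ι ι ℝ)))ᵀ * csavg M n T)) (fun y y' => CD * (((n : ℝ) ^ (d + 1))⁻¹ * σ * τ) * Real.exp (-(δ * tdistT M y y'))) :=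
      (hasMaj_comp_localRight hD1 hinner' fun y y' => by positivity).mono fun y y' => le_of_eq (by rw [hκS, hκC]; ring)
    exact hasMaj_comp_exp (ρ := δ - 3 * s) htri hd hrow (by positivity) hX (by linarith) (by linarith) (by linarith) h1 hGT
  have hs4 : HasMaj (BlockNorm.ofBlocks (unitTorusGeo L k M) (liftBlk (blockOf n M) ι)) (BlockNorm.ofBlocks (unitTorusGeo L k M) (liftBlk (fun b : Tor (fine n M) × Fin (d + 1) => blockOf n M b.1) ι)) ((Matrix.mulVecLin ((cgrad M n (fun (_ : Fin (d + 1)) (_ : Tor (fine n M)) => (1 : Matrix ι ι ℝ))) * (cGreen M n (fun (_ : Fin (d + 1)) (_ : Tor (fine n M)) => (1 : Matrix ι ι ℝ)) a)) ∘ₗ Matrix.mulVecLin ((csavg M n (fun (_ : Fin (d + 1)) (_ : Tor (fine n M)) => (1 : Matrix ι ι ℝ)))ᵀ * (csavg M n T - csavg M n (fun (_ : Fin (d + 1)) (_ : Tor (fine n M)) => (1 : Matrix ι ι ℝ))))) ∘ₗ Matrix.mulVecLin (cGreen M n T a))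
      (fun y y' => (BlockNorm.ofBlocks (unitTorusGeo L k M) (liftBlk (blockOf n M) ι)).κ * (CD * (((n : ℝ) ^ (d + 1))⁻¹ * 1 * σ)) * X * c * Real.exp (-((δ - 3 * s) * tdistT M y y'))) := by
    have hinner := hasMaj_comp_localRight hQ1t hQQ fun y y' => by positivity
    have hinner' : HasMaj (BlockNorm.ofBlocks (unitTorusGeo L k M) (liftBlk (blockOf n M) ι)) (BlockNorm.ofBlocks (unitTorusGeo L k M) (liftBlk (blockOf n M) ι)) (Matrix.mulVecLin ((csavg M n (fun (_ : Fin (d + 1)) (_ : Tor (fine n M)) => (1 : Matrix ι ι ℝ)))ᵀ * (csavg M n T - csavg M n (fun (_ : Fin (d + 1)) (_ : Tor (fine n M)) => (1 : Matrix ι ι ℝ))))) (fun y y' => if y = y' then ((n : ℝ) ^ (d + 1))⁻¹ * 1 * ((BlockNorm.ofBlocks (unitTorusGeo L k M) (liftBlk (fun y : Tor M => y) ι)).κ * σ) else 0) := by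
      rw [Matrix.mulVecLin_mul]; exact hinner.mono fun y y' => by split_ifs <;> simp
    have h1 : HasMaj (BlockNorm.ofBlocks (unitTorusGeo L k M) (liftBlk (blockOf n M) ι)) (BlockNorm.ofBlocks (unitTorusGeo L k M) (liftBlk (fun b : Tor (fine n M) × Fin (d + 1) => blockOf n M b.1) ι)) (Matrix.mulVecLin ((cgrad M n (fun (_ : Fin (d + 1)) (_ : Tor (fine n M)) => (1 : Matrix ι ι ℝ))) * (cGreen M n (fun (_ : Fin (d + 1)) (_ : Tor (fine n M)) => (1 : Matrix ι ι ℝ)) a)) ∘ₗ Matrix.mulVecLin ((csavg M n (fun (_ : Fin (d + 1)) (_ : Tor (fine n M)) => (1 : Matrix ι ι ℝ)))ᵀ * (csavg M n T - csavg M n (fun (_ : Fin (d + 1)) (_ : Tor (fine n M)) => (1 : Matrix ι ι ℝ))))) (fun y y' => CD * (((n : ℝ) ^ (d + 1))⁻¹ * 1 * σ) * Real.exp (-(δ * tdistT M y y'))) :=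
      (hasMaj_comp_localRight hD1 hinner' fun y y' => by positivity).mono fun y y' => le_of_eq (by rw [hκS, hκC]; ring)
    exact hasMaj_comp_exp (ρ := δ - 3 * s) htri hd hrow (by positivity) hX (by linarith) (by linarith) (by linarith) h1 hGT
  -- the bracket `S₂ − ∂G′(1)` at rate `δ − 3s`
  have hs3' := hs3.mono fun y y' => le_of_eq (by rw [hκS, one_mul])
  have hs4' := hs4.mono fun y y' => le_of_eq (by rw [hκS, one_mul])
  have h3 := hasMaj_smul_ofBlocks (g := unitTorusGeo L k M) (liftBlk (fun b : Tor (fine n M) × Fin (d + 1) => blockOf n M b.1) ι) (K := fun y y' => (CD * (((n : ℝ) ^ (d + 1))⁻¹ * σ * τ)) * X * c * Real.exp (-((δ - 3 * s) * tdistT M y y'))) (fun y y' => by positivity) a hs3'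
  have h4 := hasMaj_smul_ofBlocks (g := unitTorusGeo L k M) (liftBlk (fun b : Tor (fine n M) × Fin (d + 1) => blockOf n M b.1) ι) (K := fun y y' => (CD * (((n : ℝ) ^ (d + 1))⁻¹ * 1 * σ)) * X * c * Real.exp (-((δ - 3 * s) * tdistT M y y'))) (fun y y' => by positivity) a hs4'
  -- `K₂·∂G′(T)` and `B·G′(T)`
  have hKY := hasMaj_comp_exp (ρ := δ - 4 * s) htri hd hrow hθ₂0 hY0 (by linarith) (by linarith) (by linarith) hK2 hY
  have hBG := hasMaj_comp_exp (ρ := δ - 4 * s) htri hd hrow (by positivity) hX (by linarith) (by linarith) (by linarith) hBs hGT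
  -- the identity
  have hGfix : (cGreen M n T a) = (cGreen M n (fun (_ : Fin (d + 1)) (_ : Tor (fine n M)) => (1 : Matrix ι ι ℝ)) a) + (cGreen M n (fun (_ : Fin (d + 1)) (_ : Tor (fine n M)) => (1 : Matrix ι ι ℝ)) a) * (claplA M n (fun (_ : Fin (d + 1)) (_ : Tor (fine n M)) => (1 : Matrix ι ι ℝ)) a - claplA M n T a) * (cGreen M n T a) := by
    have h := cGreen_sub M n h1unit hT ha
    calc (cGreen M n T a) = (cGreen M n (fun (_ : Fin (d + 1)) (_ : Tor (fine n M)) => (1 : Matrix ι ι ℝ)) a) - ((cGreen M n (fun (_ : Fin (d + 1)) (_ : Tor (fine n M)) => (1 : Matrix ι ι ℝ)) a) - (cGreen M n T a)) := (sub_sub_cancel _ _).symm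
      _ = (cGreen M n (fun (_ : Fin (d + 1)) (_ : Tor (fine n M)) => (1 : Matrix ι ι ℝ)) a) - (cGreen M n (fun (_ : Fin (d + 1)) (_ : Tor (fine n M)) => (1 : Matrix ι ι ℝ)) a) * (claplA M n T a - claplA M n (fun (_ : Fin (d + 1)) (_ : Tor (fine n M)) => (1 : Matrix ι ι ℝ)) a) * (cGreen M n T a) := by rw [h]
      _ = (cGreen M n (fun (_ : Fin (d + 1)) (_ : Tor (fine n M)) => (1 : Matrix ι ι ℝ)) a) + (cGreen M n (fun (_ : Fin (d + 1)) (_ : Tor (fine n M)) => (1 : Matrix ι ι ℝ)) a) * (claplA M n (fun (_ : Fin (d + 1)) (_ : Tor (fine n M)) => (1 : Matrix ι ι ℝ)) a - claplA M n T a) * (cGreen M n T a) := by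
          rw [show claplA M n (fun (_ : Fin (d + 1)) (_ : Tor (fine n M)) => (1 : Matrix ι ι ℝ)) a - claplA M n T a = -(claplA M n T a - claplA M n (fun (_ : Fin (d + 1)) (_ : Tor (fine n M)) => (1 : Matrix ι ι ℝ)) a) from (neg_sub _ _).symm, Matrix.mul_neg, Matrix.neg_mul, sub_eq_add_neg]
  have hQ' : (csavg M n (fun (_ : Fin (d + 1)) (_ : Tor (fine n M)) => (1 : Matrix ι ι ℝ)))ᵀ * csavg M n (fun (_ : Fin (d + 1)) (_ : Tor (fine n M)) => (1 : Matrix ι ι ℝ)) - (csavg M n T)ᵀ * csavg M n T = -(((csavg M n T - csavg M n (fun (_ : Fin (d + 1)) (_ : Tor (fine n M)) => (1 : Matrix ι ι ℝ)))ᵀ * csavg M n T) + ((csavg M n (fun (_ : Fin (d + 1)) (_ : Tor (fine n M)) => (1 : Matrix ι ι ℝ)))ᵀ * (csavg M n T - csavg M n (fun (_ : Fin (d + 1)) (_ : Tor (fine n M)) => (1 : Matrix ι ι ℝ))))) := by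
    rw [Matrix.transpose_sub, Matrix.sub_mul, Matrix.mul_sub]; abel
  have hDGT : (cgrad M n (fun (_ : Fin (d + 1)) (_ : Tor (fine n M)) => (1 : Matrix ι ι ℝ))) * (cGreen M n T a) = (cgrad M n (fun (_ : Fin (d + 1)) (_ : Tor (fine n M)) => (1 : Matrix ι ι ℝ))) * (cGreen M n (fun (_ : Fin (d + 1)) (_ : Tor (fine n M)) => (1 : Matrix ι ι ℝ)) a) + (cgrad M n (fun (_ : Fin (d + 1)) (_ : Tor (fine n M)) => (1 : Matrix ι ι ℝ))) * (cGreen M n (fun (_ : Fin (d + 1)) (_ : Tor (fine n M)) => (1 : Matrix ι ι ℝ)) a) * ((claplA M n (fun (_ : Fin (d + 1)) (_ : Tor (fine n M)) => (1 : Matrix ι ι ℝ)) a - claplA M n T a) * (cGreen M n T a)) := by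
    conv_lhs => rw [hGfix]
    simp only [Matrix.mul_add, Matrix.mul_assoc]
  have hM : cgrad M n T * (cGreen M n T a) - (cgrad M n (fun (_ : Fin (d + 1)) (_ : Tor (fine n M)) => (1 : Matrix ι ι ℝ))) * (cGreen M n (fun (_ : Fin (d + 1)) (_ : Tor (fine n M)) => (1 : Matrix ι ι ℝ)) a) = (cgrad M n (fun (_ : Fin (d + 1)) (_ : Tor (fine n M)) => (1 : Matrix ι ι ℝ))) * (cGreen M n (fun (_ : Fin (d + 1)) (_ : Tor (fine n M)) => (1 : Matrix ι ι ℝ)) a) * ((claplA M n (fun (_ : Fin (d + 1)) (_ : Tor (fine n M)) => (1 : Matrix ι ι ℝ)) a - claplA M n T a) * (cGreen M n T a)) - ((cgrad M n (fun (_ : Fin (d + 1)) (_ : Tor (fine n M)) => (1 : Matrix ι ι ℝ))) - cgrad M n T) * (cGreen M n T a) := by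
    have hT' : cgrad M n T = (cgrad M n (fun (_ : Fin (d + 1)) (_ : Tor (fine n M)) => (1 : Matrix ι ι ℝ))) - ((cgrad M n (fun (_ : Fin (d + 1)) (_ : Tor (fine n M)) => (1 : Matrix ι ι ℝ))) - cgrad M n T) := (sub_sub_cancel _ _).symm
    rw [hT', Matrix.sub_mul, hDGT]
    abel
  have hL := cgrad_one_transpose_comp_B M n T
  set Bm := ((cgrad M n (fun (_ : Fin (d + 1)) (_ : Tor (fine n M)) => (1 : Matrix ι ι ℝ))) - cgrad M n T) with hBm
  set Q1m := ((csavg M n T - csavg M n (fun (_ : Fin (d + 1)) (_ : Tor (fine n M)) => (1 : Matrix ι ι ℝ)))ᵀ * csavg M n T) with hQ1m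
  set Q2m := ((csavg M n (fun (_ : Fin (d + 1)) (_ : Tor (fine n M)) => (1 : Matrix ι ι ℝ)))ᵀ * (csavg M n T - csavg M n (fun (_ : Fin (d + 1)) (_ : Tor (fine n M)) => (1 : Matrix ι ι ℝ)))) with hQ2m
  set DG1 := (cgrad M n (fun (_ : Fin (d + 1)) (_ : Tor (fine n M)) => (1 : Matrix ι ι ℝ))) * (cGreen M n (fun (_ : Fin (d + 1)) (_ : Tor (fine n M)) => (1 : Matrix ι ι ℝ)) a) with hDG1
  have hfix : Matrix.mulVecLin (cgrad M n T * (cGreen M n T a) - (cgrad M n (fun (_ : Fin (d + 1)) (_ : Tor (fine n M)) => (1 : Matrix ι ι ℝ))) * (cGreen M n (fun (_ : Fin (d + 1)) (_ : Tor (fine n M)) => (1 : Matrix ι ι ℝ)) a)) =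
      ((Matrix.mulVecLin DG1 ∘ₗ Matrix.mulVecLin (sDiag M n (bDiv M n (fun ν x => (n : ℝ) • ((1 : Matrix ι ι ℝ) - T ν x))))) ∘ₗ Matrix.mulVecLin (cGreen M n T a)
        - (Matrix.mulVecLin DG1 ∘ₗ (Matrix.mulVecLin Bmᵀ ∘ₗ Matrix.mulVecLin Bm)) ∘ₗ Matrix.mulVecLin (cGreen M n T a)
        - a • ((Matrix.mulVecLin DG1 ∘ₗ Matrix.mulVecLin Q1m) ∘ₗ Matrix.mulVecLin (cGreen M n T a))
        - a • ((Matrix.mulVecLin DG1 ∘ₗ Matrix.mulVecLin Q2m) ∘ₗ Matrix.mulVecLin (cGreen M n T a)))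
      + (Matrix.mulVecLin DG1 ∘ₗ (Matrix.mulVecLin Bmᵀ - Matrix.mulVecLin (bContr M n (fun ν x => (n : ℝ) • ((1 : Matrix ι ι ℝ) - T ν x))))) ∘ₗ Matrix.mulVecLin ((cgrad M n (fun (_ : Fin (d + 1)) (_ : Tor (fine n M)) => (1 : Matrix ι ι ℝ))) * (cGreen M n T a))
      - Matrix.mulVecLin Bm ∘ₗ Matrix.mulVecLin (cGreen M n T a) := by
    conv_lhs => rw [hM, claplA_one_sub_claplA, hQ', ← hBm]
    simp only [Matrix.mulVecLin_add, mulVecLin_sub', mulVecLin_smul', mulVecLin_neg', Matrix.mulVecLin_mul, smul_neg, smul_add]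
    rw [hL]
    simp only [LinearMap.comp_add, LinearMap.comp_sub, LinearMap.add_comp, LinearMap.sub_comp, LinearMap.comp_neg, LinearMap.neg_comp, LinearMap.comp_smul, LinearMap.smul_comp,
      LinearMap.comp_assoc]
    abel
  rw [hfix]
  have hbr : HasMaj (BlockNorm.ofBlocks (unitTorusGeo L k M) (liftBlk (blockOf n M) ι)) (BlockNorm.ofBlocks (unitTorusGeo L k M) (liftBlk (fun b : Tor (fine n M) × Fin (d + 1) => blockOf n M b.1) ι)) ((Matrix.mulVecLin DG1 ∘ₗ Matrix.mulVecLin (sDiag M n (bDiv M n (fun ν x => (n : ℝ) • ((1 : Matrix ι ι ℝ) - T ν x))))) ∘ₗ Matrix.mulVecLin (cGreen M n T a)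
        - (Matrix.mulVecLin DG1 ∘ₗ (Matrix.mulVecLin Bmᵀ ∘ₗ Matrix.mulVecLin Bm)) ∘ₗ Matrix.mulVecLin (cGreen M n T a)
        - a • ((Matrix.mulVecLin DG1 ∘ₗ Matrix.mulVecLin Q1m) ∘ₗ Matrix.mulVecLin (cGreen M n T a))
        - a • ((Matrix.mulVecLin DG1 ∘ₗ Matrix.mulVecLin Q2m) ∘ₗ Matrix.mulVecLin (cGreen M n T a)))
      (fun y y' => (CD * (((d : ℝ) + 1) * (n : ℝ) * ((n : ℝ) * lam)) * X * c + CD * (((n : ℝ) * ((d + 1 : ℕ) * ρ) * Real.exp (δ + s)) * ((n : ℝ) * ρ * Real.exp (δ + s)) * c) * c * X * c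
          + |a| * (CD * (((n : ℝ) ^ (d + 1))⁻¹ * σ * τ)) * X * c + |a| * (CD * (((n : ℝ) ^ (d + 1))⁻¹ * 1 * σ)) * X * c) * Real.exp (-((δ - 4 * s) * tdistT M y y'))) := by
    refine ((((hs1.sub hs2).sub h3).sub h4).mono fun y y' => le_of_eq (by rw [hκS, hκV]; ring)).of_rate_le hd (by positivity) (by linarith : δ - 4 * s ≤ δ - 3 * s)
  refine ((hbr.add hKY).sub hBG).mono fun y y' => le_of_eq ?_
  rw [hκV, hκS]
  ring

end GradDiff

end Summit.QuantumFields.YangMills.BalabanUVNodes.N15.CovLandau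

end
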